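import Literature.Analysis.FluidPDE.PassiveVectorGalerkinBlockEnergy
import Literature.Analysis.FluidPDE.PassiveVectorGalerkinModeODE
import Summits.AnomalousDissipation.AnomalousDissipation.Theorems.SolenoidalFractalHomogenisationRealisedQuasiStaticCellLawSlotWindows
import HarnessLib

/-!
# Negative side of K2Q `QuasiStaticSolenoidalCellTensorQ` (stmt-AnomalousDissipation-19072): the principal/rest energy system of
# the cell Galerkin truncation (helper, `--supports stmt-AnomalousDissipation-19072`)

Summits-side helper file (everything proved; no definitions, no named facts).  For the Fourier–Galerkin truncation
(`pvSetup_cell`, order `N` resolving the carrier modes) of the passive solenoidal vector around the `1/n`-cells of an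
ARBITRARY lattice word `W` in the Bloch sector `±ℓ + nℤ³`, this file identifies the data of the abstract window floor lemma
(`…Negative.WindowFloor.window_floor`):
* `totalEnergy_hasDerivWithinAt` — `E(t) = Σ_{k∈freqBall N} ‖α_N(t)(k)‖²` has derivative `-2κ·4π² Σ |k|²‖α_N(t)(k)‖²`;
* `principalEnergy_hasDerivWithinAt` — the principal pair energy `x(t) = ‖α_N(t)(ℓ)‖² + ‖α_N(t)(-ℓ)‖²` has derivative
  `-(2κ4π²|ℓ|²)·x + τ`, the exchange `τ` in LADDER form (`pvGalerkinField_cell`: mode `±ℓ` is fed only by `±ℓ ∓ n m_j`,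
  slot by slot, with the envelope weight of the slot);
* `activeSlot_unique` — at every time at most one slot envelope of a word is non-zero.
No long-slot hypothesis anywhere.  This is NOT a proof of anomalous dissipation, and by itself not of `¬ K2Q`.
-/

set_option linter.dupNamespace false

noncomputable section

namespace Summit.AnomalousDissipation.AnomalousDissipation.Theorems.QuasiStaticSolenoidalCellTensorQ.Negative

open Set MeasureTheory Filter Topology Function
open scoped InnerProductSpace ComplexConjugate BigOperators
open Literature.Analysis Literature.Analysis.FunctionSpaces Literature.Analysis.FunctionSpaces.Torus
open Literature.Analysis.FluidPDE Literature.Analysis.FluidPDE.LatticeShear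
open Summit.AnomalousDissipation.AnomalousDissipation.Theorems.SolenoidalFractalHomogenisation.PermissibleCarrier
open Summit.AnomalousDissipation.AnomalousDissipation.Theorems.SolenoidalFractalHomogenisation.RealisedQuasiStaticCellLaw

variable {k₀ : ℕ}

/-! ## §1 At most one slot is active at any time -/

/-- **At most one slot envelope is non-zero at any time**: if `trap_i(r) ≠ 0` then `trap_j(r) = 0` for every `j ≠ i`
(the slots `[start_j, start_j + τ_j]` tile the period and every envelope vanishes at and outside the ends of its slot). -/
theorem activeSlot_unique (W : LatticeWord k₀) (r : ℝ) {i j : Fin k₀} (hij : i ≠ j)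
    (hi : LatticeWord.trapezoid (W.start i) (W.phase i).τ W.ramp r ≠ 0) :
    LatticeWord.trapezoid (W.start j) (W.phase j).τ W.ramp r = 0 := by
  have hρτ : 0 < W.ramp * (W.phase i).τ := mul_pos W.ramp_pos (W.phase i).τ_pos
  have h1 : W.start i < r := by
    by_contra h
    exact hi (trapezoid_eq_zero_of_le hρτ (not_lt.1 h))
  have h2 : r < W.start i + (W.phase i).τ := by
    by_contra h
    exact hi (trapezoid_eq_zero_of_ge hρτ (not_lt.1 h))
  exact trapezoid_eq_zero_of_ne W hij.symm ⟨h1.le, h2.le⟩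

/-- Squared form: `trap_i(r) · trap_j(r) = 0` for `i ≠ j`. -/
theorem trapezoid_mul_trapezoid_eq_zero (W : LatticeWord k₀) (r : ℝ) {i j : Fin k₀} (hij : i ≠ j) :
    LatticeWord.trapezoid (W.start i) (W.phase i).τ W.ramp r * LatticeWord.trapezoid (W.start j) (W.phase j).τ W.ramp r = 0 := by
  by_cases hi : LatticeWord.trapezoid (W.start i) (W.phase i).τ W.ramp r = 0
  · rw [hi, zero_mul]
  · rw [activeSlot_unique W r hij hi, mul_zero]

/-! ## §2 The total truncation energy -/

/-- **Derivative of the total truncation energy** of the cell problem within `[0, T]`: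
`E'(t) = -2κ·4π² Σ_{k∈freqBall N} |k|² ‖α_N(t)(k)‖²`. -/
theorem totalEnergy_hasDerivWithinAt (W : LatticeWord k₀) {n : ℕ} (hn : 0 < n) {κ : ℝ} (hκ : 0 ≤ κ)
    (ℓ : Fin 3 → ℤ) {w₀ : UnitAddTorus (Fin 3) → EuclideanSpace ℝ (Fin 3)}
    (hw₀ : FunctionSpaces.Torus.MemSobolev 1 (FunctionSpaces.EuclideanSpace.complexify ∘ w₀))
    (hdiv : FunctionSpaces.Torus.IsWeaklyDivFree w₀) (hmean : FunctionSpaces.Torus.HasZeroMean w₀)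
    (hsupp : ∀ k : Fin 3 → ℤ, ¬ ((∃ z : Fin 3 → ℤ, k = ℓ + (n:ℤ) • z) ∨ (∃ z : Fin 3 → ℤ, k = -ℓ + (n:ℤ) • z)) →
      UnitAddTorus.mFourierCoeff (FunctionSpaces.EuclideanSpace.complexify ∘ w₀) k = 0)
    (N : ℕ) {T t : ℝ} (ht : t ∈ Icc 0 T) :
    HasDerivWithinAt (fun s => ∑ k ∈ freqBall N, ‖(pvSetup_cell W hn hκ ℓ hw₀ hdiv hmean hsupp).galerkinCoeffAt N s k‖ ^ 2)
      (-(2 * (κ * (4 * Real.pi ^ 2 * ∑ k ∈ freqBall N,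
        freqNormSq k * ‖(pvSetup_cell W hn hκ ℓ hw₀ hdiv hmean hsupp).galerkinCoeffAt N t k‖ ^ 2)))) (Icc 0 T) t := by
  set hPV := pvSetup_cell W hn hκ ℓ hw₀ hdiv hmean hsupp with hPVdef
  obtain ⟨-, hmemP, -, hsol, -⟩ := hPV.galerkinCoeff_spec N
  have h := Torus.hasDerivWithinAt_blockEnergy κ (neg_mem_freqBall_of_mem (N := N)) (hsol T t ht) (hmemP t).1
    (Torus.isRealCoeff_carrierTrunc hPV.carrier N t) (Torus.isSolenoidalCoeff_carrierTrunc hPV.carrier N t)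
    (Finset.Subset.refl _) (neg_mem_freqBall_of_mem (N := N)) (fun _ _ _ _ m hm _ _ _ => hm)
  simp only [hPV.coeffExt_galerkinCoeff] at h
  refine h.congr_deriv ?_
  ring

/-! ## §3 The principal pair in ladder form -/

/-- **Derivative of the principal pair energy in ladder form.** For `ℓ ∈ freqBall N` and the carrier modes resolved,
`x(t) = ‖α_N(t)(ℓ)‖² + ‖α_N(t)(-ℓ)‖²` has, within `[0, T]`, the derivative `-(2κ4π²|ℓ|²)·x(t) + τ(t)` with the exchange
`τ(t) = -Σ_{k=±ℓ} 2 Re⟪α_N(t)(k), Σ_j (c_j(t)·2πi(ê_j·k)) • Π_k (a_j•α_N(t)(k - K_j) + a'_j•α_N(t)(k + K_j))⟫`,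
`c_j(t) = trap_j(t)/n`, `K_j = n m_j` (`pvGalerkinField_cell`). -/
theorem principalEnergy_hasDerivWithinAt (W : LatticeWord k₀) {n : ℕ} (hn : 0 < n) {κ : ℝ} (hκ : 0 ≤ κ)
    (ℓ : Fin 3 → ℤ) {w₀ : UnitAddTorus (Fin 3) → EuclideanSpace ℝ (Fin 3)}
    (hw₀ : FunctionSpaces.Torus.MemSobolev 1 (FunctionSpaces.EuclideanSpace.complexify ∘ w₀))
    (hdiv : FunctionSpaces.Torus.IsWeaklyDivFree w₀) (hmean : FunctionSpaces.Torus.HasZeroMean w₀)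
    (hsupp : ∀ k : Fin 3 → ℤ, ¬ ((∃ z : Fin 3 → ℤ, k = ℓ + (n:ℤ) • z) ∨ (∃ z : Fin 3 → ℤ, k = -ℓ + (n:ℤ) • z)) →
      UnitAddTorus.mFourierCoeff (FunctionSpaces.EuclideanSpace.complexify ∘ w₀) k = 0)
    {N : ℕ} (hBN : (Finset.univ.biUnion fun j : Fin k₀ =>
        ({(fun i => (W.phase j).m i * n), -(fun i => (W.phase j).m i * n)} : Finset (Fin 3 → ℤ))) ⊆ freqBall N)
    (hℓ : ℓ ≠ 0) (hℓN : ℓ ∈ freqBall N) {T t : ℝ} (ht : t ∈ Icc 0 T) :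
    HasDerivWithinAt
      (fun s => ‖(pvSetup_cell W hn hκ ℓ hw₀ hdiv hmean hsupp).galerkinCoeffAt N s ℓ‖ ^ 2 +
        ‖(pvSetup_cell W hn hκ ℓ hw₀ hdiv hmean hsupp).galerkinCoeffAt N s (-ℓ)‖ ^ 2)
      (-(2 * (κ * (4 * Real.pi ^ 2 * freqNormSq ℓ))) *
          (‖(pvSetup_cell W hn hκ ℓ hw₀ hdiv hmean hsupp).galerkinCoeffAt N t ℓ‖ ^ 2 +
            ‖(pvSetup_cell W hn hκ ℓ hw₀ hdiv hmean hsupp).galerkinCoeffAt N t (-ℓ)‖ ^ 2) +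
        -(∑ k ∈ ({ℓ, -ℓ} : Finset (Fin 3 → ℤ)), 2 * (inner ℂ ((pvSetup_cell W hn hκ ℓ hw₀ hdiv hmean hsupp).galerkinCoeffAt N t k)
          (∑ j : Fin k₀, ((((1 / (n : ℝ)) *
            LatticeWord.trapezoid (W.start j) (W.phase j).τ W.ramp (Int.fract (t / W.period) * W.period) : ℝ) : ℂ) *
            (2 * Real.pi * Complex.I * ∑ i, (EuclideanSpace.complexify (W.phase j).e) i * (k i : ℂ))) •
          Torus.leraySym k
            ((Complex.exp ((W.phase j).φ * Complex.I) *
                (1 / (2 * ((2 * Real.pi * ‖latticeVec (W.phase j).m‖ : ℝ) : ℂ) * Complex.I))) •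
                (pvSetup_cell W hn hκ ℓ hw₀ hdiv hmean hsupp).galerkinCoeffAt N t (k - (fun i => (W.phase j).m i * n)) +
              (starRingEnd ℂ (Complex.exp ((W.phase j).φ * Complex.I)) *
                (-(1 / (2 * ((2 * Real.pi * ‖latticeVec (W.phase j).m‖ : ℝ) : ℂ) * Complex.I)))) •
                (pvSetup_cell W hn hκ ℓ hw₀ hdiv hmean hsupp).galerkinCoeffAt N t (k + (fun i => (W.phase j).m i * n))))).re))
      (Icc 0 T) t := by
  classical
  set hPV := pvSetup_cell W hn hκ ℓ hw₀ hdiv hmean hsupp with hPVdef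
  have hℓN' : -ℓ ∈ freqBall N := neg_mem_freqBall_of_mem ℓ hℓN
  -- the field at `±ℓ` in ladder form
  have hc : ∀ m, m ∉ freqBall N → hPV.galerkinCoeffAt N t m = 0 := fun m hm => by
    rw [Torus.PVSetup.galerkinCoeffAt, coeffExt_of_not_mem _ hm]
  have hfield := fun k => pvGalerkinField_cell W hn κ hBN hc t k
  -- derivative of each mode's energy
  have hd : ∀ k ∈ ({ℓ, -ℓ} : Finset (Fin 3 → ℤ)), HasDerivWithinAt (fun s => ‖hPV.galerkinCoeffAt N s k‖ ^ 2)
      (2 * (inner ℂ (hPV.galerkinCoeffAt N t k)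
        (Torus.pvGalerkinField κ (freqBall N) (fun l => UnitAddTorus.mFourierCoeff (EuclideanSpace.complexify ∘ W.cell n t) l)
          (hPV.galerkinCoeffAt N t) k)).re) (Icc 0 T) t := by
    intro k hk
    have hkN : k ∈ freqBall N := by
      simp only [Finset.mem_insert, Finset.mem_singleton] at hk
      rcases hk with rfl | rfl
      · exact hℓN
      · exact hℓN'
    have h := (hPV.hasDerivWithinAt_galerkinCoeffAt hBN hkN ht).norm_sq
    rw [real_inner_eq_re_inner_euclidean] at h
    exact h
  have hℓℓ : ℓ ≠ -ℓ := by
    intro h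
    apply hℓ
    funext i
    have hi := congrFun h i
    simp only [Pi.neg_apply] at hi
    have : ℓ i = 0 := by omega
    simpa using this
  -- sum over the pair
  have hsum := HasDerivWithinAt.fun_sum hd
  have e1 : (fun s => ‖hPV.galerkinCoeffAt N s ℓ‖ ^ 2 + ‖hPV.galerkinCoeffAt N s (-ℓ)‖ ^ 2) =
      fun s => ∑ k ∈ ({ℓ, -ℓ} : Finset (Fin 3 → ℤ)), ‖hPV.galerkinCoeffAt N s k‖ ^ 2 := by
    funext s
    rw [Finset.sum_pair hℓℓ]
  rw [e1]
  refine hsum.congr_deriv ?_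
  -- expand the field at `±ℓ`
  have hre : ∀ k : Fin 3 → ℤ, ∀ (a : ℝ) (v S : EuclideanSpace ℂ (Fin 3)),
      (inner ℂ v (-(((a : ℝ) : ℂ) • v) - S)).re = -(a * ‖v‖ ^ 2) - (inner ℂ v S).re := by
    intro k a v S
    rw [inner_sub_right, inner_neg_right, inner_smul_right, inner_self_eq_norm_sq_to_K]
    simp only [Complex.sub_re, Complex.neg_re, Complex.mul_re, Complex.ofReal_re, Complex.ofReal_im, zero_mul,
      sub_zero]
    norm_cast
  rw [Finset.sum_pair hℓℓ, Finset.sum_pair hℓℓ, hfield ℓ, hfield (-ℓ), hre ℓ, hre (-ℓ), freqNormSq_neg]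
  ring

end Summit.AnomalousDissipation.AnomalousDissipation.Theorems.QuasiStaticSolenoidalCellTensorQ.Negative

end
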